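import Mathlib
import HarnessLib
import Literature.MathematicalPhysics.QuantumLattice.GaugeGroups
import Literature.MathematicalPhysics.QuantumFieldTheory.ConstructiveQFTWave0
import Literature.MathematicalPhysics.QuantumFieldTheory.LatticeGaugeProofs
import Literature.MathematicalPhysics.QuantumLattice.AbelianFieldTensor
import Literature.MathematicalPhysics.QuantumLattice.AbelianMagneticFlux
import Summits.Ventures.LatticeQCDFlow.Scaling.LatticePeeling
import Summits.Ventures.LatticeQCDFlow.Scaling.LatticeEntropyU1
import Summits.Ventures.LatticeQCDFlow.Scaling.FluxTunnellingU1Explicit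
import Summits.Ventures.LatticeQCDFlow.Scaling.FluxTunnellingU1ExplicitLaw
import Summits.Ventures.LatticeQCDFlow.Scaling.FluxTunnelling
import Summits.Ventures.LatticeQCDFlow.Scaling.BoxPeel
import Summits.Ventures.LatticeQCDFlow.Scaling.RowFields
import Summits.Ventures.LatticeQCDFlow.Scaling.BalancedSliceTwist
import Summits.Ventures.LatticeQCDFlow.Scaling.BoxTouch

/-!
# LatticeQCDFlow / Scaling — the max-plaquette flux law under the 2-d `U(1)` Wilson measure: `z₁(β)²·(μ_{β,L} ⊗ κ){Q ≠ Q'} ≤ 2N·e^{−β(1 − cos(π/N))}` (v3.6 supplement)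

HONEST FRAMING: exact (Metropolis-corrected) sampling algorithms for lattice gauge theory; figures
of merit are autocorrelation/cost numbers at stated couplings and volumes; no continuum-physics
claim.

THEORY-2.md §4 (C7(b″)), §5.17.  `U(1) = Circle`, `d = 2`, torus `(ℤ/L)²`, `L` even, `2 ≤ L`,
`β ≥ 0`, `μ_{β,L} = wilsonMeasure u1Rep β`.

The max-plaquette flux law of `RowFields.lean` (`compProd_topCharge_ne_le_of_links_maxPlaquette`:
an invariant Markov pair moving only links whose plaquettes lie among `N` plane positions changes
the flux charge with stationary probability `≤ 2·μ{∃ p, dist(U_p, 1) ≥ 2 sin(π/(2N))}`) is joined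
to the one-plaquette tail of the Wilson measure proved by FANOUT row 30 (lean-1,
`Scaling/FluxTunnellingU1Explicit.lean`, `u1_pow_mul_measure_actionSum_ge_le` with one position:
`z₁(β)²·μ_{β,L}{1 − Re U_x ≥ a} ≤ e^{−βa}`), by a union bound over the `N` positions and the
identity `1 − Re u = dist(u,1)²/2`, `(2 sin(π/(2N)))²/2 = 1 − cos(π/N)`:

* `u1_z1_sq_mul_measure_dist_ge_le` — `z₁(β)²·μ_{β,L}{dist(U_x, 1) ≥ c} ≤ e^{−βc²/2}` (`c ≥ 0`);
* `u1_z1_sq_mul_measure_exists_dist_ge_le` — `z₁(β)²·μ_{β,L}{∃ p ∈ P, dist(U_p, 1) ≥ c} ≤ #P·e^{−βc²/2}`;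
* **`u1_tunnelling_links_maxPlaquette`** — for every `μ_{β,L}`-invariant Markov kernel whose steps
  a.s. change only links of `Λ`, and every non-empty set `P` of `N` plane positions containing the
  touching ones: `z₁(β)²·(μ_{β,L} ⊗ κ){Q ≠ Q'} ≤ 2N·e^{−β(1 − cos(π/N))}`;
* **`u1_tunnelling_sliceLinks`** (the `L` links of a wrapping line, `N = L`) and
  **`u1_tunnelling_boxLinks`** (the block `boxLinks 1 l` of `BoxPeel.lean`, `2 ≤ l`, `l + 1 ≤ L`,
  `N = (l-1)(l+3)`, `card_boxPositions_eq`);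
* `exp_neg_one_div_le_z1_toReal_sq` (`β ≥ 1`: `e^{−1}/(π²β) ≤ z₁(β)²`, from lean-1's
  `inv_sqrt_le_z1`) and **`u1_tunnelling_links_maxPlaquette_real`** — in real numbers, `β ≥ 1`:
  `(μ_{β,L} ⊗ κ){Q ≠ Q'} ≤ 2N·(e·π²·β)·e^{−β(1 − cos(π/N))}`;
* for comparison, the same two update sets in lean-1's patch-ACTION currency
  (`Scaling/FluxTunnellingU1ExplicitLaw.lean`, `u1_tunnelling_links`, threshold `N(1 − cos(π/N))` of
  `Scaling/FluxTunnelling.lean`): **`u1_tunnelling_sliceLinks_action`** and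
  **`u1_tunnelling_boxLinks_action`** — `z₁(β)^{n+N}·(μ_{β,L} ⊗ κ){Q ≠ Q'} ≤ 2e^{−βN(1 − cos(π/N))}`
  for every `n` with `N ≤ 2n`, `2n + 2 ≤ L²`, `N = L`, resp. `N = (l-1)(l+3)`.

READING (value-free; numbers from `HOME/lean/theory2/check/crossover97.py`, seconds, stdlib).  With
`z₁(β) ≥ e^{−1/2}/(π√β)` both laws are explicit; the smallest integer `β` at which the bound drops
below `1` is, max-plaquette / action: `N = 2`: 7 / 4; `N = 4`: 30 / 17; `N = 16`: 692 / 361;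
`N = 21` (`l = 4`): 1269 / 672; `N = 64`: 14727 / 7623 — the action law is informative from about
half the `β` and is then smaller by many orders (`N = 16`, `β = 800`: `10^{−0.8}` against
`10^{−54.5}`).  The max-plaquette exponent `β(1 − cos(π/N)) ≈ βπ²/(2N²)` is `N` times smaller than
the action exponent `≈ βπ²/(2N)`; its prefactor `z₁^{−2}` is independent of `N`, the action law's
`z₁^{−(n+N)}` is not.  Both thresholds sit at the typical-fluctuation scale once `N ≳ π√β`
(`β ≲ (N/π)²`: 26 at `N = 16`, 45 at `N = 21`), below which neither law constrains a sampler of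
`μ_{β,L}`.  By `BalancedSliceTwist.lean` / `BoxSpreadPair.lean` the max-plaquette threshold
`2 sin(π/(2N))` is the largest for which a law of this form holds for ALL invariant measures;
under `μ_{β,L}` itself it is the weaker currency.  Elementary given the cited files; nothing is
cited as a fact; no `def`.
-/

noncomputable section

namespace Summit.Ventures.LatticeQCDFlow.Theory2.Lattice.Flux

open MeasureTheory ProbabilityTheory Metric Set Filter Topology Real
open scoped ENNReal
open Literature.MathematicalPhysics.QuantumFieldTheory Literature.MathematicalPhysics.QuantumLattice

/-! ## Two identities -/

section Identities

/-- `1 − Re u = dist(u, 1)²/2` on the unit circle. [folklore] -/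
theorem one_sub_re_eq_dist_sq (u : Circle) : 1 - (u : ℂ).re = dist u 1 ^ 2 / 2 := by
  rw [U1.dist_eq_norm_coe, Circle.coe_one, Complex.sq_norm, Complex.normSq_apply]
  simp only [Complex.sub_re, Complex.one_re, Complex.sub_im, Complex.one_im, sub_zero]
  have h := Circle.normSq_coe u
  rw [Complex.normSq_apply] at h
  linear_combination (-(1 : ℝ) / 2) * h

/-- `(2 sin(π/(2N)))²/2 = 1 − cos(π/N)`. [folklore] -/
theorem two_sin_sq_div_two {N : ℝ} (hN : N ≠ 0) :
    (2 * Real.sin (π / (2 * N))) ^ 2 / 2 = 1 - Real.cos (π / N) := by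
  have h : π / N = 2 * (π / (2 * N)) := by field_simp
  rw [h, Real.cos_two_mul, mul_pow, Real.cos_sq']
  ring

end Identities

/-! ## One-plaquette tails of the Wilson measure in the max-plaquette currency -/

section Tails

variable {L : ℕ} [NeZero L]

/-- `z₁(β)²·μ_{β,L}{dist(U_x, 1) ≥ c} ≤ e^{−βc²/2}` (`L` even, `2 ≤ L`, `β ≥ 0`, `c ≥ 0`): lean-1's
one-position patch-action tail and `1 − Re u = dist(u,1)²/2`. [folklore] -/
theorem u1_z1_sq_mul_measure_dist_ge_le (hL : 2 ≤ L) (hLe : Even L) {β : ℝ} (hβ : 0 ≤ β)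
    (x : Site 2 L) {c : ℝ} (hc : 0 ≤ c) :
    z1 u1Rep β ^ 2 * wilsonMeasure (d := 2) (L := L) u1Rep β
        {U | c ≤ dist (plaquetteHolonomy U x 0 1) 1} ≤
      ENNReal.ofReal (Real.exp (-(β * (c ^ 2 / 2)))) := by
  have hn : 2 * 1 + 2 ≤ L ^ 2 := le_trans (by norm_num) (Nat.pow_le_pow_left hL 2)
  have h := TwoDim.u1_pow_mul_measure_actionSum_ge_le hL hLe hβ {x} 1 (by simp) hn (c ^ 2 / 2)
  rw [Finset.card_singleton, show (1 : ℕ) + 1 = 2 from rfl] at h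
  refine le_trans (mul_le_mul_right (measure_mono ?_) _) h
  intro U hU
  simp only [Set.mem_setOf_eq, Finset.sum_singleton] at hU ⊢
  rw [one_sub_re_eq_dist_sq]
  exact div_le_div_of_nonneg_right (pow_le_pow_left₀ hc hU 2) zero_le_two

/-- Union bound: `z₁(β)²·μ_{β,L}{∃ p ∈ P, dist(U_p, 1) ≥ c} ≤ #P·e^{−βc²/2}`. [folklore] -/
theorem u1_z1_sq_mul_measure_exists_dist_ge_le (hL : 2 ≤ L) (hLe : Even L) {β : ℝ} (hβ : 0 ≤ β)
    (x₀ : Site 2 L) (P : Finset (ZMod L × ZMod L)) {c : ℝ} (hc : 0 ≤ c) :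
    z1 u1Rep β ^ 2 * wilsonMeasure (d := 2) (L := L) u1Rep β
        {U | ∃ p ∈ P, c ≤ dist (plaquetteHolonomy U (planeSite x₀ 0 1 p) 0 1) 1} ≤
      P.card * ENNReal.ofReal (Real.exp (-(β * (c ^ 2 / 2)))) := by
  set μW := wilsonMeasure (d := 2) (L := L) u1Rep β with hμW
  have hU : {U : GaugeConfig 2 L Circle | ∃ p ∈ P,
      c ≤ dist (plaquetteHolonomy U (planeSite x₀ 0 1 p) 0 1) 1} =
      ⋃ p ∈ P, {U | c ≤ dist (plaquetteHolonomy U (planeSite x₀ 0 1 p) 0 1) 1} := by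
    ext U; simp only [Set.mem_setOf_eq, Set.mem_iUnion, exists_prop]
  rw [hU]
  calc z1 u1Rep β ^ 2 * μW (⋃ p ∈ P, {U | c ≤ dist (plaquetteHolonomy U (planeSite x₀ 0 1 p) 0 1) 1})
      ≤ z1 u1Rep β ^ 2 * ∑ p ∈ P, μW {U | c ≤ dist (plaquetteHolonomy U (planeSite x₀ 0 1 p) 0 1) 1} :=
        mul_le_mul_right (measure_biUnion_finset_le P _) _
    _ = ∑ p ∈ P, z1 u1Rep β ^ 2 * μW {U | c ≤ dist (plaquetteHolonomy U (planeSite x₀ 0 1 p) 0 1) 1} :=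
        Finset.mul_sum _ _ _
    _ ≤ ∑ p ∈ P, ENNReal.ofReal (Real.exp (-(β * (c ^ 2 / 2)))) :=
        Finset.sum_le_sum fun p _ => u1_z1_sq_mul_measure_dist_ge_le hL hLe hβ _ hc
    _ = P.card * ENNReal.ofReal (Real.exp (-(β * (c ^ 2 / 2)))) := by
        rw [Finset.sum_const, nsmul_eq_mul]

end Tails

/-! ## The law under the Wilson measure -/

section Law

variable {L : ℕ} [NeZero L]

/-- **LINK-LOCAL FLUX TUNNELLING UNDER THE 2-d `U(1)` WILSON MEASURE, max-plaquette currency**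
(`L` even, `2 ≤ L`, `β ≥ 0`): for every `μ_{β,L}`-invariant Markov kernel whose steps a.s. change only
links of `Λ`, and every non-empty set `P` of plane positions containing those whose plaquette touches
`Λ`, `z₁(β)²·(μ_{β,L} ⊗ κ){Q ≠ Q'} ≤ 2·#P·e^{−β(1 − cos(π/#P))}`. [folklore] -/
theorem u1_tunnelling_links_maxPlaquette (hL : 2 ≤ L) (hLe : Even L) {β : ℝ} (hβ : 0 ≤ β)
    (x₀ : Site 2 L) (Λ : Finset (Edge 2 L)) {P : Finset (ZMod L × ZMod L)} (hPne : P.Nonempty)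
    (hP : ∀ p, (∃ e ∈ plaqLinks (planeSite x₀ 0 1 p) 0 1, e ∈ Λ) → p ∈ P)
    (κ : Kernel (GaugeConfig 2 L Circle) (GaugeConfig 2 L Circle)) [IsMarkovKernel κ]
    (hinv : κ.Invariant (wilsonMeasure (d := 2) (L := L) u1Rep β))
    (hloc : ∀ᵐ q ∂((wilsonMeasure (d := 2) (L := L) u1Rep β) ⊗ₘ κ), ∀ e ∉ Λ, q.1 e = q.2 e) :
    z1 u1Rep β ^ 2 * ((wilsonMeasure (d := 2) (L := L) u1Rep β) ⊗ₘ κ)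
        {q | topCharge x₀ 0 1 q.1 ≠ topCharge x₀ 0 1 q.2} ≤
      2 * P.card * ENNReal.ofReal (Real.exp (-(β * (1 - Real.cos (π / P.card))))) := by
  set μW := wilsonMeasure (d := 2) (L := L) u1Rep β with hμW
  haveI : IsProbabilityMeasure μW := isProbabilityMeasure_wilsonMeasure u1Rep continuous_u1Rep β
  have hlaw := compProd_topCharge_ne_le_of_links_maxPlaquette x₀ 0 1 Λ hPne hP μW κ hinv hloc
  have hN1 : (1 : ℝ) ≤ P.card := by exact_mod_cast Finset.card_pos.mpr hPne
  have hc0 : 0 ≤ 2 * Real.sin (π / (2 * P.card)) := by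
    refine mul_nonneg zero_le_two (Real.sin_nonneg_of_nonneg_of_le_pi
      (div_nonneg Real.pi_pos.le (by linarith)) ?_)
    rw [div_le_iff₀ (by linarith)]; nlinarith [Real.pi_pos]
  have htail := u1_z1_sq_mul_measure_exists_dist_ge_le hL hLe hβ x₀ P hc0
  rw [two_sin_sq_div_two (by linarith)] at htail
  calc z1 u1Rep β ^ 2 * (μW ⊗ₘ κ) {q | topCharge x₀ 0 1 q.1 ≠ topCharge x₀ 0 1 q.2}
      ≤ z1 u1Rep β ^ 2 * (2 * μW {U | ∃ p ∈ P, 2 * Real.sin (π / (2 * P.card)) ≤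
          dist (plaquetteHolonomy U (planeSite x₀ 0 1 p) 0 1) 1}) := mul_le_mul_right hlaw _
    _ = 2 * (z1 u1Rep β ^ 2 * μW {U | ∃ p ∈ P, 2 * Real.sin (π / (2 * P.card)) ≤
          dist (plaquetteHolonomy U (planeSite x₀ 0 1 p) 0 1) 1}) := by ring
    _ ≤ 2 * (P.card * ENNReal.ofReal (Real.exp (-(β * (1 - Real.cos (π / P.card)))))) :=
        mul_le_mul_right htail _
    _ = _ := by ring

/-- **ON A WRAPPING LINE** (`N = L`): every exact sampler of `μ_{β,L}` in equilibrium whose steps move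
only the `L` links of `sliceLinks L` changes the flux charge with probability per step
`≤ 2L·e^{−β(1 − cos(π/L))}/z₁(β)²`. [folklore] -/
theorem u1_tunnelling_sliceLinks (hL : 2 ≤ L) (hLe : Even L) {β : ℝ} (hβ : 0 ≤ β)
    (κ : Kernel (GaugeConfig 2 L Circle) (GaugeConfig 2 L Circle)) [IsMarkovKernel κ]
    (hinv : κ.Invariant (wilsonMeasure (d := 2) (L := L) u1Rep β))
    (hloc : ∀ᵐ q ∂((wilsonMeasure (d := 2) (L := L) u1Rep β) ⊗ₘ κ),
      ∀ e ∉ sliceLinks L, q.1 e = q.2 e) :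
    z1 u1Rep β ^ 2 * ((wilsonMeasure (d := 2) (L := L) u1Rep β) ⊗ₘ κ)
        {q | topCharge (0 : Site 2 L) 0 1 q.1 ≠ topCharge (0 : Site 2 L) 0 1 q.2} ≤
      2 * L * ENNReal.ofReal (Real.exp (-(β * (1 - Real.cos (π / L))))) := by
  have hne : (linePositions L).Nonempty := ⟨(0, 0), mem_linePositions.mpr rfl⟩
  have h := u1_tunnelling_links_maxPlaquette hL hLe hβ (0 : Site 2 L) (sliceFinset L) hne
    (mem_linePositions_of_touch) κ hinv (by
      filter_upwards [hloc] with q hq e he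
      exact hq e (by rwa [mem_sliceFinset] at he))
  rwa [card_linePositions] at h

variable {l : ℕ}

omit [NeZero L] in
/-- For `l + 1 ≤ L` the touching positions of the block are exactly `(l+1)² - 4 = (l-1)(l+3)`.
[folklore] -/
theorem card_boxPositions_eq (hl : 2 ≤ l) (hlL : l + 1 ≤ L) :
    (boxPositions l L).card = (l + 1) * (l + 1) - 4 := by
  rw [boxPositions, Finset.card_image_of_injOn, card_boxPositionsNat hl]
  rintro ⟨a, b⟩ hab ⟨a', b'⟩ hab' h
  simp only [Finset.mem_coe, boxPositionsNat, Finset.mem_filter, Finset.mem_product,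
    Finset.mem_range] at hab hab'
  simp only [Prod.mk.injEq] at h ⊢
  obtain ⟨h1, h2⟩ := h
  have h1' := (ZMod.natCast_eq_natCast_iff' a a' L).mp h1
  have h2' := (ZMod.natCast_eq_natCast_iff' b b' L).mp h2
  rw [Nat.mod_eq_of_lt (by omega), Nat.mod_eq_of_lt (by omega)] at h1' h2'
  exact ⟨h1', h2'⟩

omit [NeZero L] in
/-- The same count as a real number: `# boxPositions = (l-1)(l+3)`. [folklore] -/
theorem card_boxPositions_eq_real (hl : 2 ≤ l) (hlL : l + 1 ≤ L) :
    ((boxPositions l L).card : ℝ) = ((l : ℝ) - 1) * ((l : ℝ) + 3) := by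
  rw [card_boxPositions_eq hl hlL]
  have h4 : 4 ≤ (l + 1) * (l + 1) := by nlinarith
  rw [Nat.cast_sub h4]; push_cast; ring

/-- **ON AN `l`-BLOCK** (`2 ≤ l`, `l + 1 ≤ L`, `N = (l-1)(l+3)`): every exact sampler of `μ_{β,L}` in
equilibrium whose steps move only `boxLinks 1 l` changes the flux charge with probability per step
`≤ 2(l-1)(l+3)·e^{−β(1 − cos(π/((l-1)(l+3))))}/z₁(β)²`. [folklore] -/
theorem u1_tunnelling_boxLinks (hL : 2 ≤ L) (hLe : Even L) {β : ℝ} (hβ : 0 ≤ β) (hl : 2 ≤ l)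
    (hlL : l + 1 ≤ L)
    (κ : Kernel (GaugeConfig 2 L Circle) (GaugeConfig 2 L Circle)) [IsMarkovKernel κ]
    (hinv : κ.Invariant (wilsonMeasure (d := 2) (L := L) u1Rep β))
    (hloc : ∀ᵐ q ∂((wilsonMeasure (d := 2) (L := L) u1Rep β) ⊗ₘ κ),
      ∀ e ∉ boxLinks (1 : Site 2 L) l, q.1 e = q.2 e) :
    z1 u1Rep β ^ 2 * ((wilsonMeasure (d := 2) (L := L) u1Rep β) ⊗ₘ κ)
        {q | topCharge (0 : Site 2 L) 0 1 q.1 ≠ topCharge (0 : Site 2 L) 0 1 q.2} ≤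
      2 * ENNReal.ofReal ((((l : ℝ) - 1) * ((l : ℝ) + 3)) *
        Real.exp (-(β * (1 - Real.cos (π / (((l : ℝ) - 1) * ((l : ℝ) + 3))))))) := by
  have h11 : ((1 : ℕ), (1 : ℕ)) ∈ boxPositionsNat l := by
    unfold boxPositionsNat
    simp only [Finset.mem_filter, Finset.mem_product, Finset.mem_range]
    omega
  have hne : (boxPositions l L).Nonempty := ⟨_, Finset.mem_image_of_mem _ h11⟩
  have h := u1_tunnelling_links_maxPlaquette hL hLe hβ (0 : Site 2 L) (boxFinset l L) hne
    (mem_boxPositions_of_touch hl hlL) κ hinv (by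
      filter_upwards [hloc] with q hq e he
      exact hq e (by rwa [mem_boxFinset] at he))
  have hN0 : 0 ≤ ((l : ℝ) - 1) * ((l : ℝ) + 3) := by
    have : (2 : ℝ) ≤ l := by exact_mod_cast hl
    nlinarith
  rw [ENNReal.ofReal_mul hN0, ← mul_assoc, ← card_boxPositions_eq_real hl hlL, ENNReal.ofReal_natCast]
  exact h

/-- **ON A WRAPPING LINE, patch-action currency** (lean-1's `u1_tunnelling_links` with `N = L`):
`z₁(β)^{n+L}·(μ_{β,L} ⊗ κ){Q ≠ Q'} ≤ 2e^{−βL(1 − cos(π/L))}` for `L ≤ 2n`, `2n + 2 ≤ L²`. [folklore] -/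
theorem u1_tunnelling_sliceLinks_action (hL : 2 ≤ L) (hLe : Even L) {β : ℝ} (hβ : 0 ≤ β)
    (n : ℕ) (hn : L ≤ 2 * n) (hnL : 2 * n + 2 ≤ L ^ 2)
    (κ : Kernel (GaugeConfig 2 L Circle) (GaugeConfig 2 L Circle)) [IsMarkovKernel κ]
    (hinv : κ.Invariant (wilsonMeasure (d := 2) (L := L) u1Rep β))
    (hloc : ∀ᵐ q ∂((wilsonMeasure (d := 2) (L := L) u1Rep β) ⊗ₘ κ),
      ∀ e ∉ sliceLinks L, q.1 e = q.2 e) :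
    z1 u1Rep β ^ (n + L) * ((wilsonMeasure (d := 2) (L := L) u1Rep β) ⊗ₘ κ)
        {q | topCharge (0 : Site 2 L) 0 1 q.1 ≠ topCharge (0 : Site 2 L) 0 1 q.2} ≤
      2 * ENNReal.ofReal (Real.exp (-(β * ((L : ℝ) * (1 - Real.cos (π / L)))))) := by
  have hne : (linePositions L).Nonempty := ⟨(0, 0), mem_linePositions.mpr rfl⟩
  have h := TwoDim.u1_tunnelling_links hL hLe hβ (0 : Site 2 L) (sliceFinset L) hne
    (mem_linePositions_of_touch) n (by rw [card_linePositions]; exact hn) hnL κ hinv (by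
      filter_upwards [hloc] with q hq e he
      exact hq e (by rwa [mem_sliceFinset] at he))
  rwa [card_linePositions] at h

/-- **ON AN `l`-BLOCK, patch-action currency** (lean-1's `u1_tunnelling_links` with
`N = (l-1)(l+3) = (l+1)² - 4`, `2 ≤ l`, `l + 1 ≤ L`): `z₁(β)^{n+N}·(μ_{β,L} ⊗ κ){Q ≠ Q'} ≤
2e^{−βN(1 − cos(π/N))}` for `N ≤ 2n`, `2n + 2 ≤ L²`. [folklore] -/
theorem u1_tunnelling_boxLinks_action (hL : 2 ≤ L) (hLe : Even L) {β : ℝ} (hβ : 0 ≤ β)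
    (hl : 2 ≤ l) (hlL : l + 1 ≤ L) (n : ℕ) (hn : (l + 1) * (l + 1) - 4 ≤ 2 * n)
    (hnL : 2 * n + 2 ≤ L ^ 2)
    (κ : Kernel (GaugeConfig 2 L Circle) (GaugeConfig 2 L Circle)) [IsMarkovKernel κ]
    (hinv : κ.Invariant (wilsonMeasure (d := 2) (L := L) u1Rep β))
    (hloc : ∀ᵐ q ∂((wilsonMeasure (d := 2) (L := L) u1Rep β) ⊗ₘ κ),
      ∀ e ∉ boxLinks (1 : Site 2 L) l, q.1 e = q.2 e) :
    z1 u1Rep β ^ (n + ((l + 1) * (l + 1) - 4)) * ((wilsonMeasure (d := 2) (L := L) u1Rep β) ⊗ₘ κ)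
        {q | topCharge (0 : Site 2 L) 0 1 q.1 ≠ topCharge (0 : Site 2 L) 0 1 q.2} ≤
      2 * ENNReal.ofReal (Real.exp (-(β * ((((l : ℝ) - 1) * ((l : ℝ) + 3)) *
        (1 - Real.cos (π / (((l : ℝ) - 1) * ((l : ℝ) + 3)))))))) := by
  have h11 : ((1 : ℕ), (1 : ℕ)) ∈ boxPositionsNat l := by
    unfold boxPositionsNat
    simp only [Finset.mem_filter, Finset.mem_product, Finset.mem_range]
    omega
  have hne : (boxPositions l L).Nonempty := ⟨_, Finset.mem_image_of_mem _ h11⟩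
  have h := TwoDim.u1_tunnelling_links hL hLe hβ (0 : Site 2 L) (boxFinset l L) hne
    (mem_boxPositions_of_touch hl hlL) n (by rw [card_boxPositions_eq hl hlL]; exact hn) hnL κ hinv
    (by
      filter_upwards [hloc] with q hq e he
      exact hq e (by rwa [mem_boxFinset] at he))
  rwa [card_boxPositions_eq_real hl hlL, card_boxPositions_eq hl hlL] at h

end Law

/-! ## In real numbers, `β ≥ 1` -/

section RealForm

variable {L : ℕ} [NeZero L]

/-- `z₁(β)` is finite (`≤ 1`). [folklore] -/
theorem z1_u1_ne_top {β : ℝ} (hβ : 0 ≤ β) : z1 u1Rep β ≠ ⊤ :=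
  ne_top_of_le_ne_top ENNReal.one_ne_top (z1_le_one u1Rep U1.re_trace_u1Rep_le hβ)

/-- `e^{−1}/(π²β) ≤ z₁(β)²` in real numbers for `β ≥ 1` (lean-1's `inv_sqrt_le_z1`, squared).
[folklore] -/
theorem exp_neg_one_div_le_z1_toReal_sq {β : ℝ} (hβ : 1 ≤ β) :
    Real.exp (-1) / (π ^ 2 * β) ≤ (z1 u1Rep β).toReal ^ 2 := by
  have hβ0 : 0 < β := by linarith
  have ha : Real.exp (-(1 / 2)) * (1 / Real.pi * (Real.sqrt β)⁻¹) ≤ (z1 u1Rep β).toReal := by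
    have h := TwoDim.inv_sqrt_le_z1 hβ
    rw [← ENNReal.ofReal_toReal (z1_u1_ne_top hβ0.le),
      ENNReal.ofReal_le_ofReal_iff ENNReal.toReal_nonneg] at h
    exact h
  have ha0 : 0 ≤ Real.exp (-(1 / 2)) * (1 / Real.pi * (Real.sqrt β)⁻¹) := by positivity
  have hsq := pow_le_pow_left₀ ha0 ha 2
  have he : Real.exp (-(1 / 2)) ^ 2 = Real.exp (-1) := by
    rw [← Real.exp_nat_mul]; norm_num
  have hrew : (Real.exp (-(1 / 2)) * (1 / Real.pi * (Real.sqrt β)⁻¹)) ^ 2 =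
      Real.exp (-1) / (π ^ 2 * β) := by
    rw [mul_pow, mul_pow, inv_pow, Real.sq_sqrt hβ0.le, he]
    field_simp
  rwa [hrew] at hsq

/-- **THE LAW IN REAL NUMBERS** (`β ≥ 1`, `L` even, `2 ≤ L`): for every `μ_{β,L}`-invariant Markov
kernel changing only links of `Λ` and every non-empty `P ⊇` touching positions, `#P = N`:
`(μ_{β,L} ⊗ κ){Q ≠ Q'} ≤ 2N·(e·π²·β)·e^{−β(1 − cos(π/N))}`.  For the `L` links of a wrapping line
`N = L`; for the block `boxLinks 1 l` (`l + 1 ≤ L`) `N = (l-1)(l+3)`. [folklore] -/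
theorem u1_tunnelling_links_maxPlaquette_real (hL : 2 ≤ L) (hLe : Even L) {β : ℝ} (hβ : 1 ≤ β)
    (x₀ : Site 2 L) (Λ : Finset (Edge 2 L)) {P : Finset (ZMod L × ZMod L)} (hPne : P.Nonempty)
    (hP : ∀ p, (∃ e ∈ plaqLinks (planeSite x₀ 0 1 p) 0 1, e ∈ Λ) → p ∈ P)
    (κ : Kernel (GaugeConfig 2 L Circle) (GaugeConfig 2 L Circle)) [IsMarkovKernel κ]
    (hinv : κ.Invariant (wilsonMeasure (d := 2) (L := L) u1Rep β))
    (hloc : ∀ᵐ q ∂((wilsonMeasure (d := 2) (L := L) u1Rep β) ⊗ₘ κ), ∀ e ∉ Λ, q.1 e = q.2 e) :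
    (((wilsonMeasure (d := 2) (L := L) u1Rep β) ⊗ₘ κ).real
        {q | topCharge x₀ 0 1 q.1 ≠ topCharge x₀ 0 1 q.2}) ≤
      2 * P.card * (Real.exp 1 * π ^ 2 * β) *
        Real.exp (-(β * (1 - Real.cos (π / P.card)))) := by
  have hβ0 : 0 ≤ β := by linarith
  have hβp : 0 < β := by linarith
  set μW := wilsonMeasure (d := 2) (L := L) u1Rep β with hμW
  haveI : IsProbabilityMeasure μW := isProbabilityMeasure_wilsonMeasure u1Rep continuous_u1Rep β
  set S : Set (GaugeConfig 2 L Circle × GaugeConfig 2 L Circle) :=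
    {q | topCharge x₀ 0 1 q.1 ≠ topCharge x₀ 0 1 q.2} with hS
  set E : ℝ := Real.exp (-(β * (1 - Real.cos (π / P.card)))) with hE
  have H := u1_tunnelling_links_maxPlaquette hL hLe hβ0 x₀ Λ hPne hP κ hinv hloc
  have hzt := z1_u1_ne_top hβ0
  set z : ℝ := (z1 u1Rep β).toReal with hz
  -- the `ENNReal` law in real numbers: `z² · P(S) ≤ 2N·E`
  have hne : z1 u1Rep β ^ 2 * (μW ⊗ₘ κ) S ≠ ⊤ :=
    ENNReal.mul_ne_top (ENNReal.pow_ne_top hzt) (measure_ne_top _ _)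
  have key : z ^ 2 * (μW ⊗ₘ κ).real S ≤ 2 * P.card * E := by
    have h1 := (ENNReal.toReal_le_toReal hne (by
      exact ENNReal.mul_ne_top (ENNReal.mul_ne_top ENNReal.ofNat_ne_top (ENNReal.natCast_ne_top _))
        ENNReal.ofReal_ne_top)).mpr H
    rw [ENNReal.toReal_mul, ENNReal.toReal_pow, ENNReal.toReal_mul, ENNReal.toReal_mul,
      ENNReal.toReal_ofReal (Real.exp_pos _).le, ENNReal.toReal_natCast] at h1
    simpa [measureReal_def] using h1
  -- `1/z² ≤ e·π²·β`
  have hlow := exp_neg_one_div_le_z1_toReal_sq hβ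
  have ha2 : 0 < Real.exp (-1) / (π ^ 2 * β) := by positivity
  have hz2 : 0 < z ^ 2 := lt_of_lt_of_le ha2 hlow
  have hNE : 0 ≤ 2 * (P.card : ℝ) * E := by positivity
  have hinv' : (Real.exp (-1) / (π ^ 2 * β))⁻¹ = Real.exp 1 * π ^ 2 * β := by
    rw [inv_div, Real.exp_neg, div_inv_eq_mul]; ring
  calc (μW ⊗ₘ κ).real S = z ^ 2 * (μW ⊗ₘ κ).real S / z ^ 2 := by
          rw [eq_div_iff hz2.ne', mul_comm]
    _ ≤ 2 * P.card * E / z ^ 2 := div_le_div_of_nonneg_right key hz2.le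
    _ ≤ 2 * P.card * E / (Real.exp (-1) / (π ^ 2 * β)) := div_le_div_of_nonneg_left hNE ha2 hlow
    _ = 2 * P.card * (Real.exp 1 * π ^ 2 * β) * E := by rw [div_eq_mul_inv, hinv']; ring

end RealForm

end Summit.Ventures.LatticeQCDFlow.Theory2.Lattice.Flux
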